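import Literature.Analysis.FluidPDE.OseenKernelSideFibre
import Literature.Analysis.FluidPDE.NSBoundedMildOseenRestart
import Literature.Analysis.FluidPDE.WeakGradientIBP
import Literature.Analysis.UnboundedOperators.HeatKernelBoundedData
import HarnessLib

/-!
# The planar reduction of the Oseen identity for fields independent of `x₂`

Analysis/FluidPDE support file (all results proved) for Step 5 of the proof of
Koch–Nadirashvili–Seregin–Šverák 2009, Theorem 6.2 (arXiv:0709.3599, p. 13), used by
`KNSSTypeIRateLiouvilleOfPlanar` to derive the named fact `KNSS2009_typeI_rate_liouville`
(`KNSSTypeIRateCore`) from Theorem 5.1. For a bounded field `W` on `ℝ³` invariant under vertical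
translations (`W y = W (ι (P y))`, the rendering of "independent of the `x₂`-variable"):

* the slice integral of the three-dimensional Oseen kernel against `W ⊗ W` is an integral over
  the plane of the fibre integrals of `OseenKernelSideFibre`
  (`integral_oseenKernel_sub_of_planarInvariant`), so that the planar part of the
  three-dimensional Duhamel term `B^ν_s(W, W)(t)(x)` is the two-dimensional Duhamel term of the
  planar trace `V(τ, w) = P W(τ, ι w)` at `P x` (`sidePlane_oseenDuhamel_of_planarInvariant`), and
  the whole three-dimensional Duhamel term vanishes once the planar part of `W` does
  (`oseenDuhamel_eq_zero_of_sidePlane_eq_zero` — "this easily implies that `w = 0`");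
* the caloric extension of `W` is the planar caloric extension of its trace
  (`heatExtension_of_planarInvariant`);
* the planar trace of a weakly divergence-free `W` is weakly divergence free in the plane
  (`IsWeaklyDivFree.planarTrace`: test with `θ(Px)χ(x₁)`, `χ` a normalised bump, the cross term
  carrying `∫ χ' = 0`).

## Mathlib / tree search

`OseenKernelLineIntegrals` (§R3) draws the consequences of its special fibre integrals for bounded
measurable data invariant under `y ↦ y + δe₁`: `∫ K(σ, x − y)[g(y)e₁, c(y)] dy = 0`
(`integral_oseenKernel_sub_smul_single_left`) and `⟪∫ K(σ, x − y)[a(y), g(y)e₁] dy, v⟫ = 0` for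
`v ⊥ e₁` (`inner_integral_oseenKernel_sub_smul_single_right`), with the integrability of the
kernel against bounded fields (`integrable_oseenKernel_sub_of_bounded`; here the tree's earlier
`integrable_oseenKernel_comp_sub_of_bound` of `NSBoundedMildOseenRestart` is used). The present
file instead transports the *general* fibre identity of `OseenKernelSideFibre`: the full slice
integral `∫ K(σ, x − y)[W(y), W(y)] dy` of an invariant field is the planar integral of
`sideSplit.symm (transport, K²[PW, PW])` (`integral_oseenKernel_sub_of_planarInvariant`), which
gives at once the planar Duhamel term of the trace (`sidePlane_oseenDuhamel_of_planarInvariant`)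
and the vanishing for axial data (`oseenDuhamel_eq_zero_of_sidePlane_eq_zero`, the content of the
`left` lemma of that file for `g e₁ ⊗ g e₁`). The caloric reduction
`heatExtension_of_planarInvariant` and the weak-divergence transfer `IsWeaklyDivFree.planarTrace`
have no counterpart there. Mathlib: `ContinuousLinearMap.integral_comp_comm`,
`integral_sub_left_eq_self`, `ContDiffBump.normed` (`integral_normed`),
`integral_eq_zero_of_hasDerivAt_of_integrable` (`∫ χ' = 0`), `HasCompactSupport.intro`.

## References

* G. Koch, N. Nadirashvili, G. Seregin, V. Šverák, *Liouville theorems for the Navier–Stokes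
  equations and applications*, Acta Math. 203 (2009) 83–105 = arXiv:0709.3599: proof of
  Theorem 6.2, p. 13 ("since the solutions `v⁽ᵏ⁾` are axi-symmetric and `M_k ↗ ∞`, it is easy to see
  that `w` is independent of the `x₂`-variable. Applying Theorem 5.1 and Remark 6.1 to the field
  `(w₁, w₃)`, we conclude that `(w₁, w₃)` must vanish identically, and this easily implies that
  `w = 0`"); §3, p. 6 (the kernel `K_{ijk}` of the representation formula (3.3)); §4, p. 8 (the
  bilinear form `B`). [KochNadirashviliSereginSverak2009]
-/

noncomputable section

open MeasureTheory Set Function Filter WithLp Real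
open scoped RealInnerProductSpace ENNReal NNReal

namespace Literature.Analysis.FluidPDE

/-! ### Planar-invariant fields -/

section PlanarInvariant

variable {τ : ℝ} {W : (EuclideanSpace ℝ (Fin 3)) → (EuclideanSpace ℝ (Fin 3))} {M : ℝ}

/-- The kernel integrand along a fibre, for a field invariant under vertical translations. [folklore] -/
theorem oseenKernel_sub_sideSplit_symm_of_planarInvariant
    (hWinv : ∀ y, W y = W (sideEmbed (sidePlane y))) (x : (EuclideanSpace ℝ (Fin 3))) (r : ℝ) (w : (EuclideanSpace ℝ (Fin 2))) :
    oseenKernel τ (x - sideSplit.symm (r, w)) (W (sideSplit.symm (r, w))) (W (sideSplit.symm (r, w))) =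
      oseenKernel τ (sideSplit.symm (x 1 - r, sidePlane x - w)) (W (sideEmbed w))
        (W (sideEmbed w)) := by
  rw [hWinv (sideSplit.symm (r, w)), sidePlane_sideSplit_symm]
  conv_lhs => rw [← sideSplit_symm_fst_sidePlane x, sideSplit_symm_sub]

/-- **The slice integral of the three-dimensional Oseen kernel against a field invariant under
vertical translations, as an integral over the plane.** [cite: KochNadirashviliSereginSverak2009, proof of Thm 6.2 (arXiv p. 13) with §3 p. 6] -/
theorem integral_oseenKernel_sub_of_planarInvariant (hτ : 0 < τ) (hWm : AEMeasurable W volume)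
    (hWb : ∀ y, ‖W y‖ ≤ M) (hWinv : ∀ y, W y = W (sideEmbed (sidePlane y))) (x : (EuclideanSpace ℝ (Fin 3))) :
    Integrable (fun w : (EuclideanSpace ℝ (Fin 2)) => sideSplit.symm
        (-(⟪sidePlane x - w, sidePlane (W (sideEmbed w))⟫ / (2 * τ) *
            UnboundedOperators.heatKernel τ (sidePlane x - w) * (W (sideEmbed w)) 1),
          oseenKernel τ (sidePlane x - w) (sidePlane (W (sideEmbed w)))
            (sidePlane (W (sideEmbed w))))) ∧
    ∫ y, oseenKernel τ (x - y) (W y) (W y) =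
      ∫ w : (EuclideanSpace ℝ (Fin 2)), sideSplit.symm
        (-(⟪sidePlane x - w, sidePlane (W (sideEmbed w))⟫ / (2 * τ) *
            UnboundedOperators.heatKernel τ (sidePlane x - w) * (W (sideEmbed w)) 1),
          oseenKernel τ (sidePlane x - w) (sidePlane (W (sideEmbed w)))
            (sidePlane (W (sideEmbed w)))) := by
  have hF := integrable_oseenKernel_comp_sub_of_bound hτ hWm hWm hWb hWb x
  have hfib : ∀ w : (EuclideanSpace ℝ (Fin 2)), ∫ r, oseenKernel τ (x - sideSplit.symm (r, w)) (W (sideSplit.symm (r, w)))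
      (W (sideSplit.symm (r, w))) = sideSplit.symm
        (-(⟪sidePlane x - w, sidePlane (W (sideEmbed w))⟫ / (2 * τ) *
            UnboundedOperators.heatKernel τ (sidePlane x - w) * (W (sideEmbed w)) 1),
          oseenKernel τ (sidePlane x - w) (sidePlane (W (sideEmbed w)))
            (sidePlane (W (sideEmbed w)))) := by
    intro w
    simp_rw [oseenKernel_sub_sideSplit_symm_of_planarInvariant hWinv x]
    calc ∫ r, oseenKernel τ (sideSplit.symm (x 1 - r, sidePlane x - w)) (W (sideEmbed w))
          (W (sideEmbed w))
        = ∫ r, oseenKernel τ (sideSplit.symm (r, sidePlane x - w)) (W (sideEmbed w))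
          (W (sideEmbed w)) :=
          integral_sub_left_eq_self (fun r => oseenKernel τ (sideSplit.symm (r, sidePlane x - w))
            (W (sideEmbed w)) (W (sideEmbed w))) volume (x 1)
      _ = _ := integral_oseenKernel_fiber' hτ _ _ _
  refine ⟨(integrable_integral_fiber hF).congr (ae_of_all _ hfib), ?_⟩
  rw [integral_eq_integral_integral_sideSplit hF]
  exact integral_congr_ae (ae_of_all _ hfib)

/-- **The caloric extension of a bounded continuous function invariant under vertical
translations is the planar caloric extension of its trace.** [folklore] -/
theorem heatExtension_of_planarInvariant {V : Type*} [NormedAddCommGroup V] [NormedSpace ℝ V]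
    [CompleteSpace V] {t : ℝ} (ht : 0 < t) {f : (EuclideanSpace ℝ (Fin 3)) → V} (hfc : Continuous f) {C : ℝ}
    (hfb : ∀ y, ‖f y‖ ≤ C) (hfinv : ∀ y, f y = f (sideEmbed (sidePlane y))) (x : (EuclideanSpace ℝ (Fin 3))) :
    UnboundedOperators.heatExtension f t x =
      UnboundedOperators.heatExtension (fun w => f (sideEmbed w)) t (sidePlane x) := by
  rw [UnboundedOperators.heatExtension_apply, UnboundedOperators.heatExtension_apply]
  have hF := UnboundedOperators.integrable_heatKernel_smul_of_bound hfc hfb ht x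
  rw [integral_eq_integral_integral_sideSplit hF]
  refine integral_congr_ae (ae_of_all _ fun w => ?_)
  dsimp only
  have h1 : ∀ r, UnboundedOperators.heatKernel t (sideSplit.symm (r, w)) • f (x - sideSplit.symm (r, w)) =
      (UnboundedOperators.heatKernel t w * UnboundedOperators.heatKernel (E := ℝ) t r) •
        f (sideEmbed (sidePlane x - w)) := by
    intro r
    rw [heatKernel_sideSplit_symm ht, hfinv (x - _), map_sub, sidePlane_sideSplit_symm]
  simp_rw [h1]
  rw [integral_smul_const, integral_const_mul, integral_heatKernel_real ht, mul_one]

end PlanarInvariant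

/-! ### The Duhamel term of a field invariant under vertical translations -/

section Duhamel

variable {ν : ℝ} {W : ℝ → (EuclideanSpace ℝ (Fin 3)) → (EuclideanSpace ℝ (Fin 3))} {M : ℝ}

/-- **The planar part of the three-dimensional Duhamel term is the planar Duhamel term of the
planar part.** [cite: KochNadirashviliSereginSverak2009, proof of Thm 6.2 (arXiv p. 13), "Applying Theorem 5.1 and Remark 6.1 to the field (w₁, w₃)", with §4 p. 8 (the bilinear form B)] -/
theorem sidePlane_oseenDuhamel_of_planarInvariant (hν : 0 < ν) (hWm : Measurable (uncurry W))
    (hWb : ∀ τ y, ‖W τ y‖ ≤ M) (hWinv : ∀ τ y, W τ y = W τ (sideEmbed (sidePlane y)))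
    {s t : ℝ} (hst : s < t) (x : (EuclideanSpace ℝ (Fin 3))) :
    sidePlane (oseenDuhamel ν s W W t x) =
      oseenDuhamel ν s (fun τ w => sidePlane (W τ (sideEmbed w)))
        (fun τ w => sidePlane (W τ (sideEmbed w))) t (sidePlane x) := by
  rw [oseenDuhamel_apply, oseenDuhamel_apply,
    ← sidePlane.integral_comp_comm (integrableOn_integral_oseenKernel_slab hν hWm hWb hst le_rfl x)]
  refine setIntegral_congr_fun measurableSet_Ioo fun τ hτ => ?_
  have hσ : 0 < ν * (t - τ) := mul_pos hν (sub_pos.2 hτ.2)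
  have hWmτ : AEMeasurable (W τ) volume := (hWm.comp measurable_prodMk_left).aemeasurable
  obtain ⟨hint, heq⟩ := integral_oseenKernel_sub_of_planarInvariant hσ hWmτ (hWb τ) (hWinv τ) x
  rw [heq, ← sidePlane.integral_comp_comm hint]
  refine integral_congr_ae (ae_of_all _ fun w => ?_)
  simp only [sidePlane_sideSplit_symm]

/-- **The three-dimensional Duhamel term of a field invariant under vertical translations and
with vanishing planar part vanishes.** [cite: KochNadirashviliSereginSverak2009, proof of Thm 6.2 (arXiv p. 13), "this easily implies that w = 0"] -/
theorem oseenDuhamel_eq_zero_of_sidePlane_eq_zero (hν : 0 < ν) (hWm : Measurable (uncurry W))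
    (hWb : ∀ τ y, ‖W τ y‖ ≤ M) (hWinv : ∀ τ y, W τ y = W τ (sideEmbed (sidePlane y)))
    (hW0 : ∀ τ y, sidePlane (W τ y) = 0) (s t : ℝ) (x : (EuclideanSpace ℝ (Fin 3))) :
    oseenDuhamel ν s W W t x = 0 := by
  rw [oseenDuhamel_apply]
  refine setIntegral_eq_zero_of_forall_eq_zero fun τ hτ => ?_
  have hσ : 0 < ν * (t - τ) := mul_pos hν (sub_pos.2 hτ.2)
  have hWmτ : AEMeasurable (W τ) volume := (hWm.comp measurable_prodMk_left).aemeasurable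
  obtain ⟨-, heq⟩ := integral_oseenKernel_sub_of_planarInvariant hσ hWmτ (hWb τ) (hWinv τ) x
  rw [heq]
  refine integral_eq_zero_of_ae (ae_of_all _ fun w => ?_)
  simp only [hW0, inner_zero_right, zero_div, zero_mul, neg_zero, oseenKernel_zero_left, Pi.zero_apply]
  have : sideSplit.symm ((0 : ℝ), (0 : (EuclideanSpace ℝ (Fin 2)))) = 0 := by ext i; fin_cases i <;> simp
  exact this

end Duhamel

/-! ### Weak divergence-freeness of the planar trace -/

section DivFree

/-- A normalised smooth bump on the line. [folklore] -/
theorem exists_normalized_bump :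
    ∃ χ : ℝ → ℝ, ContDiff ℝ (⊤ : ℕ∞) χ ∧ HasCompactSupport χ ∧ ∫ r, χ r = 1 := by
  let f : ContDiffBump (0 : ℝ) := ⟨1, 2, zero_lt_one, one_lt_two⟩
  exact ⟨f.normed volume, f.contDiff_normed, f.hasCompactSupport_normed, f.integral_normed⟩

/-- **The planar trace of a weakly divergence-free continuous field invariant under vertical
translations is weakly divergence free in the plane** (test the three-dimensional field with
`θ(Px) χ(x₁)`, `χ` a normalised bump: the cross term carries `∫ χ' = 0`). [folklore] -/
theorem IsWeaklyDivFree.planarTrace {W : (EuclideanSpace ℝ (Fin 3)) → (EuclideanSpace ℝ (Fin 3))} (hW : IsWeaklyDivFree W) (hWc : Continuous W)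
    (hWinv : ∀ y, W y = W (sideEmbed (sidePlane y))) :
    IsWeaklyDivFree (fun w : (EuclideanSpace ℝ (Fin 2)) => sidePlane (W (sideEmbed w))) := by
  intro θ hθ
  obtain ⟨χ, hχs, hχc, hχ1⟩ := exists_normalized_bump
  have hθd : Differentiable ℝ θ := hθ.contDiff.differentiable (by simp)
  have hχd : Differentiable ℝ χ := hχs.differentiable (by simp)
  -- the lifted test function `Θ(x) = θ(Px) χ(x₁)`
  set Θ : (EuclideanSpace ℝ (Fin 3)) → ℝ := fun x => θ (sidePlane x) * χ (x 1) with hΘ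
  have hproj : ContDiff ℝ (⊤ : ℕ∞) (fun x : (EuclideanSpace ℝ (Fin 3)) => x 1) :=
    (EuclideanSpace.proj (1 : Fin 3) : (EuclideanSpace ℝ (Fin 3)) →L[ℝ] ℝ).contDiff
  have hΘs : ContDiff ℝ (⊤ : ℕ∞) Θ := (hθ.contDiff.comp sidePlane.contDiff).mul (hχs.comp hproj)
  have hΘc : HasCompactSupport Θ := by
    refine HasCompactSupport.intro
      (K := (fun p : ℝ × (EuclideanSpace ℝ (Fin 2)) => sideSplit.symm p) '' (tsupport χ ×ˢ tsupport θ)) ?_ ?_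
    · exact (hχc.isCompact.prod hθ.hasCompactSupport.isCompact).image continuous_sideSplit_symm
    · intro x hx
      have hx' : (x 1, sidePlane x) ∉ tsupport χ ×ˢ tsupport θ := fun h =>
        hx ⟨(x 1, sidePlane x), h, sideSplit_symm_fst_sidePlane x⟩
      rw [Set.mem_prod, not_and_or] at hx'
      simp only [hΘ]
      rcases hx' with h | h
      · rw [image_eq_zero_of_notMem_tsupport h, mul_zero]
      · rw [image_eq_zero_of_notMem_tsupport h, zero_mul]
  have hΘt : FunctionSpaces.IsTestFunctionOn (⊤ : TopologicalSpace.Opens (EuclideanSpace ℝ (Fin 3))) Θ :=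
    ⟨hΘs, hΘc, fun _ _ => trivial⟩
  -- its derivative
  have hDΘ : ∀ x v, fderiv ℝ Θ x v =
      θ (sidePlane x) * (v 1 * deriv χ (x 1)) + χ (x 1) * fderiv ℝ θ (sidePlane x) (sidePlane v) := by
    intro x v
    have h1 : HasFDerivAt (fun y : (EuclideanSpace ℝ (Fin 3)) => θ (sidePlane y))
        ((fderiv ℝ θ (sidePlane x)).comp sidePlane) x :=
      (hθd (sidePlane x)).hasFDerivAt.comp x sidePlane.hasFDerivAt
    have hP1 : HasFDerivAt (fun y : (EuclideanSpace ℝ (Fin 3)) => y 1) (EuclideanSpace.proj (1 : Fin 3) : (EuclideanSpace ℝ (Fin 3)) →L[ℝ] ℝ) x :=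
      (EuclideanSpace.proj (1 : Fin 3) : (EuclideanSpace ℝ (Fin 3)) →L[ℝ] ℝ).hasFDerivAt
    have h2 : HasFDerivAt (fun y : (EuclideanSpace ℝ (Fin 3)) => χ (y 1))
        ((ContinuousLinearMap.smulRight (1 : ℝ →L[ℝ] ℝ) (deriv χ (x 1))).comp
          (EuclideanSpace.proj (1 : Fin 3) : (EuclideanSpace ℝ (Fin 3)) →L[ℝ] ℝ)) x :=
      (hχd (x 1)).hasDerivAt.hasFDerivAt.comp x hP1
    have h3 : HasFDerivAt Θ (θ (sidePlane x) •
        ((ContinuousLinearMap.smulRight (1 : ℝ →L[ℝ] ℝ) (deriv χ (x 1))).comp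
          (EuclideanSpace.proj (1 : Fin 3) : (EuclideanSpace ℝ (Fin 3)) →L[ℝ] ℝ)) +
        χ (x 1) • ((fderiv ℝ θ (sidePlane x)).comp sidePlane)) x := h1.mul h2
    rw [h3.fderiv]
    simp [smul_eq_mul]
  -- the pairing as a compactly supported continuous function
  have hgradc : HasCompactSupport (gradient Θ) := by
    show HasCompactSupport (fun x => (InnerProductSpace.toDual ℝ (EuclideanSpace ℝ (Fin 3))).symm (fderiv ℝ Θ x))
    exact (hΘc.fderiv (𝕜 := ℝ)).comp_left (g := fun L => (InnerProductSpace.toDual ℝ (EuclideanSpace ℝ (Fin 3))).symm L)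
      (map_zero _)
  have hgradcont : Continuous (gradient Θ) :=
    (InnerProductSpace.toDual ℝ (EuclideanSpace ℝ (Fin 3))).symm.continuous.comp
      (hΘs.continuous_fderiv (by simp))
  have hGc : HasCompactSupport (fun x => ⟪W x, gradient Θ x⟫) := by
    refine hgradc.mono fun x hx => ?_
    intro h
    exact hx (by simp only [h, inner_zero_right])
  have hGi : Integrable (fun x => ⟪W x, gradient Θ x⟫) :=
    (hWc.inner hgradcont).integrable_of_hasCompactSupport hGc
  have h0 := hW Θ hΘt
  rw [integral_eq_integral_integral_sideSplit hGi] at h0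
  -- the fibre integrals
  have hχi : Integrable χ := hχs.continuous.integrable_of_hasCompactSupport hχc
  have hχ'i : Integrable (deriv χ) :=
    (hχs.continuous_deriv (by exact_mod_cast le_top)).integrable_of_hasCompactSupport hχc.deriv
  have hχ'0 : ∫ r, deriv χ r = 0 :=
    integral_eq_zero_of_hasDerivAt_of_integrable (fun r => (hχd r).hasDerivAt) hχ'i hχi
  have hfib : ∀ w : (EuclideanSpace ℝ (Fin 2)), ∫ r, ⟪W (sideSplit.symm (r, w)), gradient Θ (sideSplit.symm (r, w))⟫ =
      fderiv ℝ θ w (sidePlane (W (sideEmbed w))) := by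
    intro w
    have hpt : ∀ r, ⟪W (sideSplit.symm (r, w)), gradient Θ (sideSplit.symm (r, w))⟫ =
        (θ w * (W (sideEmbed w)) 1) * deriv χ r +
          fderiv ℝ θ w (sidePlane (W (sideEmbed w))) * χ r := by
      intro r
      rw [inner_gradient_eq_fderiv_apply, hDΘ, hWinv (sideSplit.symm (r, w)), sidePlane_sideSplit_symm,
        sideSplit_symm_apply_one]
      ring
    simp_rw [hpt]
    rw [integral_add ((hχ'i.const_mul _)) (hχi.const_mul _), integral_const_mul, integral_const_mul,
      hχ'0, hχ1]
    ring
  simp_rw [hfib] at h0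
  rw [← h0]
  exact integral_congr_ae (ae_of_all _ fun w => inner_gradient_eq_fderiv_apply (θ := θ) w _)

end DivFree

end Literature.Analysis.FluidPDE

end
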